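import Summits.CriticalPhenomena.CardyFormulaZ2.Theorems.CardyComplexConeParafermionToSLESixFamiliesDiamondTouchLowerHalfPlane
import Summits.CriticalPhenomena.CardyFormulaZ2.Theorems.CardyComplexConeParafermionToSLESixFamiliesDiamondTouchLowerFrames
import HarnessLib

/-!
# The ring, the connector and the arm of the free-side touch bound in lattice coordinates
# (line `potential-darboux-picard-diamond`, S3 (c) `freeTouchLower_of_diagArmLower`, part 3)

Crux `ParafermionToSLESixFamilies` (stmt-CriticalPhenomena-11389). The interior of a diamond discretisation with last layers
`n : Fin 4 → ℤ` (side `k`: tangential coordinate `layerFn (k + 3)`, depth `dp[n, k, ·] = n k − 2 − layerFn (k + 2)`,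
`…TouchLowerFrames`) is `boxI[n] = {∀ j, 0 ≤ dp[n, j, ·]}`; in the frame of ANY side `k` it is the coordinate box
`[2 − n (k+3), n (k+1) − 2] × [0, n k + n (k+2) − 4]` (`boxI_eq`), and the strips `strip[n, w, j]` of depth `≤ w` along the
sides are its bottom / right / top / left strips (`strip_self`, `strip_succ`, `strip_add_two`, `strip_add_three`). So the
abstract gluing lemmas of `…TouchLowerHalfPlane` (`ring_conn`, `connector_conn`, `arm_conn`), instantiated in the frames
with their drawings `SE[n, k]`, give the coordinate-free `site_conn`: on the ring event `ringEv[n, w]`, the connector event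
`connEv[n, w, k', lo]` of side `k'` and the arm-with-U events of a touch-row site `x` of side `k`, the site `x` is joined inside
`boxI[n] ∪ connQ[n, w, k', lo]` to a site of depth `−1` of the connector. Local notation only (no new definitions).
-/

noncomputable section

namespace Summit.CriticalPhenomena.CardyFormulaZ2.Cruxes.ParafermionToSLESixFamilies.PotentialDarbouxPicardDiamond

open MeasureTheory Set Complex
open Literature.Probability Literature.Probability.LatticeModels Literature.Probability.Percolation

/-- The depth of `v` below the touch row of side `k` (last inside layer `n k`). -/
local notation3 "dp[" n ", " k ", " v "]" => (n : Fin 4 → ℤ) k - 2 - layerFn (k + 2) v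
/-- The rotation of side `k`. -/
local notation3 "SR[" k "]" => (![zdSignedPermIso (Equiv.swap 0 1) ![-1, 1], zdSignedPermIso 1 (fun _ => -1),
    zdSignedPermIso (Equiv.swap 0 1) ![1, -1], zdSignedPermIso 1 (fun _ => 1)] : Fin 4 → (zdGraph 2 ≃g zdGraph 2)) k
/-- The lattice automorphism based at the site `x` of side `k`. -/
local notation3 "SI[" k ", " x "]" => (zdShiftIso ((SR[k]).symm x)).trans SR[k]
/-- The angle of the drawing of side `k`. -/
local notation3 "SA[" k "]" => (![-(Real.pi / 2), Real.pi, Real.pi / 2, 0] : Fin 4 → ℝ) k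
/-- The isoradial drawing of side `k`. -/
local notation3 "SE[" n ", " k "]" => (gmEmbedding (fun _ => SA[k]) (fun _ => SA[k] + Real.pi / 2)).translate
    ((((n : Fin 4 → ℤ) k - 2 : ℤ) : ℂ) * I)
/-- The interior of the lattice box: depth `≥ 0` below all four touch rows. -/
local notation3 "boxI[" n "]" => {v : Site 2 | ∀ j : Fin 4, 0 ≤ dp[n, j, v]}
/-- The strip of depth `≤ w` along side `j`, inside the interior. -/
local notation3 "strip[" n ", " w ", " j "]" => {v : Site 2 | (∀ i : Fin 4, 0 ≤ dp[n, i, v]) ∧ dp[n, j, v] ≤ w}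
/-- The touch row of side `j` (depth `0`). -/
local notation3 "face[" n ", " j "]" => {v : Site 2 | dp[n, j, v] = 0}
/-- The crossing event of the strip of side `j` (the long way, from the touch row of side `j + 3` to that of `j + 1`). -/
local notation3 "crossEv[" n ", " w ", " j "]" => openCrossing strip[n, w, j] face[n, j + 3] face[n, j + 1]
/-- The ring event: all four strips are crossed the long way. -/
local notation3 "ringEv[" n ", " w "]" => ⋂ j : Fin 4, crossEv[n, w, j]
/-- The connector of side `k` at tangential position `lo`: the box `[lo, lo + w] × [−1, w]` of the frame of side `k`. -/
local notation3 "connQ[" n ", " w ", " k ", " lo "]" => {v : Site 2 | lo ≤ layerFn (k + 3) v ∧ layerFn (k + 3) v ≤ lo + w ∧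
    -1 ≤ dp[n, k, v] ∧ dp[n, k, v] ≤ w}
/-- The connector event: the connector is crossed from the boundary layer `dp = −1` to the depth `w`. -/
local notation3 "connEv[" n ", " w ", " k ", " lo "]" => openCrossing connQ[n, w, k, lo] {v : Site 2 | dp[n, k, v] = -1}
    {v : Site 2 | dp[n, k, v] = w}
/-- The arm event of the touch-row site `x` of side `k` to half-plane distance `N`. -/
local notation3 "armEv[" n ", " k ", " x ", " N "]" => openCrossing
    {v : Site 2 | 0 ≤ dp[n, k, v] ∧ max |layerFn (k + 3) v - layerFn (k + 3) x| (dp[n, k, v] - dp[n, k, x]) ≤ N} {x}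
    {v : Site 2 | max |layerFn (k + 3) v - layerFn (k + 3) x| (dp[n, k, v] - dp[n, k, x]) = N}
/-- The U event at scale `m` around the site `x` of side `k` (two pillars crossed across, one bar crossed along). -/
local notation3 "uEv[" n ", " k ", " x ", " m "]" =>
    openCrossing {v : Site 2 | layerFn (k + 3) x + m ≤ layerFn (k + 3) v ∧ layerFn (k + 3) v ≤ layerFn (k + 3) x + 2 * m ∧
        0 ≤ dp[n, k, v] ∧ dp[n, k, v] ≤ dp[n, k, x] + 2 * m} {v : Site 2 | dp[n, k, v] = 0}
        {v : Site 2 | dp[n, k, v] = dp[n, k, x] + 2 * m} ∩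
      openCrossing {v : Site 2 | layerFn (k + 3) x - 2 * m ≤ layerFn (k + 3) v ∧ layerFn (k + 3) v ≤ layerFn (k + 3) x + 2 * m ∧
        dp[n, k, x] + m ≤ dp[n, k, v] ∧ dp[n, k, v] ≤ dp[n, k, x] + 2 * m} {v : Site 2 | layerFn (k + 3) v = layerFn (k + 3) x - 2 * m}
        {v : Site 2 | layerFn (k + 3) v = layerFn (k + 3) x + 2 * m} ∩
      openCrossing {v : Site 2 | layerFn (k + 3) x - 2 * m ≤ layerFn (k + 3) v ∧ layerFn (k + 3) v ≤ layerFn (k + 3) x - m ∧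
        0 ≤ dp[n, k, v] ∧ dp[n, k, v] ≤ dp[n, k, x] + 2 * m} {v : Site 2 | dp[n, k, v] = 0}
        {v : Site 2 | dp[n, k, v] = dp[n, k, x] + 2 * m}
/-- The vertical connector event at `x`: the box `[tng x − m, tng x + m] × [0, 3m]` of side `k` is crossed across. -/
local notation3 "vEv[" n ", " k ", " x ", " m "]" => openCrossing
    {v : Site 2 | layerFn (k + 3) x - m ≤ layerFn (k + 3) v ∧ layerFn (k + 3) v ≤ layerFn (k + 3) x + m ∧ 0 ≤ dp[n, k, v] ∧
      dp[n, k, v] ≤ 3 * m} {v : Site 2 | dp[n, k, v] = 0} {v : Site 2 | dp[n, k, v] = 3 * m}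

/-! ## The coordinates of the neighbouring frames -/

section Ids

variable (n : Fin 4 → ℤ) (k : Fin 4) (x : Site 2)

/-- The tangential coordinate of the next side is the depth of this one, up to a constant. -/
theorem tng_succ : layerFn (k + 1 + 3) x = dp[n, k, x] - (n k - 2) := by
  rw [fin4_add_one_add_three, layerFn_add_two]
  ring

/-- The depth of the next side is minus the tangential coordinate of this one, up to a constant. -/
theorem dp_succ : dp[n, k + 1, x] = n (k + 1) - 2 - layerFn (k + 3) x := by
  rw [fin4_add_one_add_two]

/-- Opposite sides have opposite tangential coordinates. -/
theorem tng_add_two : layerFn (k + 2 + 3) x = -layerFn (k + 3) x := by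
  rw [fin4_add_two_add_three, ← fin4_add_one_add_two, layerFn_add_two, neg_neg]

/-- The depths of opposite sides add up to the total depth `n k + n (k+2) − 4`. -/
theorem dp_add_two : dp[n, k + 2, x] = n k + n (k + 2) - 4 - dp[n, k, x] := by
  rw [fin4_add_two_add_two', layerFn_add_two]
  ring

/-- The tangential coordinate of the previous side. -/
theorem tng_add_three : layerFn (k + 3 + 3) x = n k - 2 - dp[n, k, x] := by
  rw [fin4_add_three_add_three]
  ring

/-- The depth of the previous side. -/
theorem dp_add_three : dp[n, k + 3, x] = n (k + 3) - 2 + layerFn (k + 3) x := by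
  rw [DiscreteDobrushin.fin4_three_two, ← fin4_add_one_add_two, layerFn_add_two]
  ring

/-- **The interior in the frame of side `k`.** -/
theorem forall_dp_nonneg_iff : (∀ j, 0 ≤ dp[n, j, x]) ↔
    2 - n (k + 3) ≤ layerFn (k + 3) x ∧ layerFn (k + 3) x ≤ n (k + 1) - 2 ∧ 0 ≤ dp[n, k, x] ∧ dp[n, k, x] ≤ n k + n (k + 2) - 4 := by
  constructor
  · intro h
    have h0 := h k
    have h1 := h (k + 1)
    have h2 := h (k + 2)
    have h3 := h (k + 3)
    rw [dp_succ] at h1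
    rw [dp_add_two] at h2
    rw [dp_add_three] at h3
    omega
  · rintro ⟨h3, h1, h0, h2⟩ j
    obtain ⟨m, rfl⟩ := exists_eq_add k j
    fin_cases m
    · simpa using h0
    · show 0 ≤ dp[n, k + 1, x]
      rw [dp_succ]; omega
    · show 0 ≤ dp[n, k + 2, x]
      rw [dp_add_two]; omega
    · show 0 ≤ dp[n, k + 3, x]
      rw [dp_add_three]; omega

end Ids

/-- `openCrossing` is symmetric in its two targets. -/
theorem openCrossing_comm {V : Type*} (S A B : Set V) : openCrossing S A B = openCrossing S B A := by
  ext ω; simp only [mem_openCrossing_iff]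
  exact ⟨fun ⟨x, hx, y, hy, h⟩ => ⟨y, hy, x, hx, by rwa [openConnIn_comm]⟩,
    fun ⟨x, hx, y, hy, h⟩ => ⟨y, hy, x, hx, by rwa [openConnIn_comm]⟩⟩

/-! ## The dictionary: the regions in the frame of side `k` -/

section Dict

variable (n : Fin 4 → ℤ) {w : ℤ} (k : Fin 4) (hw : ∀ j, w ≤ n j + n (j + 2) - 4)

include hw in
/-- The width bound read on the next side. -/
theorem width_succ : w ≤ n (k + 1) + n (k + 3) - 4 := by
  have := hw (k + 1); rwa [fin4_add_one_add_two] at this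

/-- The interior in the frame of side `k`. -/
theorem boxI_eq : boxI[n] = {v : Site 2 | 2 - n (k + 3) ≤ layerFn (k + 3) v ∧ layerFn (k + 3) v ≤ n (k + 1) - 2 ∧ 0 ≤ dp[n, k, v] ∧
    dp[n, k, v] ≤ n k + n (k + 2) - 4} := by
  ext v; exact forall_dp_nonneg_iff n k v

include hw in
/-- The strip of side `k` in its own frame: the bottom strip. -/
theorem strip_self : strip[n, w, k] =
    {v : Site 2 | 2 - n (k + 3) ≤ layerFn (k + 3) v ∧ layerFn (k + 3) v ≤ n (k + 1) - 2 ∧ 0 ≤ dp[n, k, v] ∧ dp[n, k, v] ≤ w} := by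
  have := hw k
  ext v
  simp only [mem_setOf_eq, forall_dp_nonneg_iff n k v]
  omega

include hw in
/-- The strip of side `k + 1` in the frame of side `k`: the right strip. -/
theorem strip_succ : strip[n, w, k + 1] =
    {v : Site 2 | n (k + 1) - 2 - w ≤ layerFn (k + 3) v ∧ layerFn (k + 3) v ≤ n (k + 1) - 2 ∧ 0 ≤ dp[n, k, v] ∧
      dp[n, k, v] ≤ n k + n (k + 2) - 4} := by
  have := width_succ n k hw
  ext v
  simp only [mem_setOf_eq, forall_dp_nonneg_iff n k v, dp_succ]
  omega

include hw in
/-- The strip of side `k + 2` in the frame of side `k`: the top strip. -/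
theorem strip_add_two : strip[n, w, k + 2] =
    {v : Site 2 | 2 - n (k + 3) ≤ layerFn (k + 3) v ∧ layerFn (k + 3) v ≤ n (k + 1) - 2 ∧ n k + n (k + 2) - 4 - w ≤ dp[n, k, v] ∧
      dp[n, k, v] ≤ n k + n (k + 2) - 4} := by
  have := hw k
  ext v
  simp only [mem_setOf_eq, forall_dp_nonneg_iff n k v, dp_add_two]
  omega

include hw in
/-- The strip of side `k + 3` in the frame of side `k`: the left strip. -/
theorem strip_add_three : strip[n, w, k + 3] =
    {v : Site 2 | 2 - n (k + 3) ≤ layerFn (k + 3) v ∧ layerFn (k + 3) v ≤ 2 - n (k + 3) + w ∧ 0 ≤ dp[n, k, v] ∧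
      dp[n, k, v] ≤ n k + n (k + 2) - 4} := by
  have := width_succ n k hw
  ext v
  simp only [mem_setOf_eq, forall_dp_nonneg_iff n k v, dp_add_three]
  omega

/-- The touch row of side `k + 3` in the frame of side `k`: the left edge. -/
theorem face_add_three : face[n, k + 3] = {v : Site 2 | layerFn (k + 3) v = 2 - n (k + 3)} := by
  ext v; simp only [mem_setOf_eq, dp_add_three]; omega

/-- The touch row of side `k + 1` in the frame of side `k`: the right edge. -/
theorem face_succ : face[n, k + 1] = {v : Site 2 | layerFn (k + 3) v = n (k + 1) - 2} := by
  ext v; simp only [mem_setOf_eq, dp_succ]; omega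

/-- The touch row of side `k + 2` in the frame of side `k`: the top edge. -/
theorem face_add_two : face[n, k + 2] = {v : Site 2 | dp[n, k, v] = n k + n (k + 2) - 4} := by
  ext v; simp only [mem_setOf_eq, dp_add_two]; omega

include hw in
/-- The crossing of side `k` in its own frame: left–right across the bottom strip. -/
theorem crossEv_self : crossEv[n, w, k] =
    openCrossing {v : Site 2 | 2 - n (k + 3) ≤ layerFn (k + 3) v ∧ layerFn (k + 3) v ≤ n (k + 1) - 2 ∧ 0 ≤ dp[n, k, v] ∧ dp[n, k, v] ≤ w}
      {v : Site 2 | layerFn (k + 3) v = 2 - n (k + 3)} {v : Site 2 | layerFn (k + 3) v = n (k + 1) - 2} := by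
  rw [strip_self n k hw, face_add_three, face_succ]

include hw in
/-- The crossing of side `k + 1` in the frame of side `k`: bottom–top across the right strip. -/
theorem crossEv_succ : crossEv[n, w, k + 1] =
    openCrossing {v : Site 2 | n (k + 1) - 2 - w ≤ layerFn (k + 3) v ∧ layerFn (k + 3) v ≤ n (k + 1) - 2 ∧ 0 ≤ dp[n, k, v] ∧
        dp[n, k, v] ≤ n k + n (k + 2) - 4}
      {v : Site 2 | dp[n, k, v] = 0} {v : Site 2 | dp[n, k, v] = n k + n (k + 2) - 4} := by
  rw [strip_succ n k hw, fin4_add_one_add_three, fin4_add_one_add_one, face_add_two]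

include hw in
/-- The crossing of side `k + 2` in the frame of side `k`: right–left across the top strip. -/
theorem crossEv_add_two : crossEv[n, w, k + 2] =
    openCrossing {v : Site 2 | 2 - n (k + 3) ≤ layerFn (k + 3) v ∧ layerFn (k + 3) v ≤ n (k + 1) - 2 ∧
        n k + n (k + 2) - 4 - w ≤ dp[n, k, v] ∧ dp[n, k, v] ≤ n k + n (k + 2) - 4}
      {v : Site 2 | layerFn (k + 3) v = 2 - n (k + 3)} {v : Site 2 | layerFn (k + 3) v = n (k + 1) - 2} := by
  rw [strip_add_two n k hw, fin4_add_two_add_three, fin4_add_two_add_one, face_succ, face_add_three, openCrossing_comm]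

include hw in
/-- The crossing of side `k + 3` in the frame of side `k`: top–bottom across the left strip. -/
theorem crossEv_add_three : crossEv[n, w, k + 3] =
    openCrossing {v : Site 2 | 2 - n (k + 3) ≤ layerFn (k + 3) v ∧ layerFn (k + 3) v ≤ 2 - n (k + 3) + w ∧ 0 ≤ dp[n, k, v] ∧
        dp[n, k, v] ≤ n k + n (k + 2) - 4}
      {v : Site 2 | dp[n, k, v] = 0} {v : Site 2 | dp[n, k, v] = n k + n (k + 2) - 4} := by
  rw [strip_add_three n k hw, fin4_add_three_add_three, fin4_add_three_add_one, face_add_two, openCrossing_comm]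

/-- The ring event lists the four crossings starting from any side. -/
theorem mem_ringEv_iff (w : ℤ) {ω : BondConfig (Site 2)} :
    ω ∈ ringEv[n, w] ↔ ω ∈ crossEv[n, w, k] ∧ ω ∈ crossEv[n, w, k + 1] ∧ ω ∈ crossEv[n, w, k + 2] ∧ ω ∈ crossEv[n, w, k + 3] := by
  simp only [mem_iInter]
  constructor
  · intro h; exact ⟨h k, h _, h _, h _⟩
  · rintro ⟨h0, h1, h2, h3⟩ j
    obtain ⟨m, rfl⟩ := exists_eq_add k j
    fin_cases m
    · simpa using h0
    · exact h1
    · exact h2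
    · exact h3

end Dict

/-! ## The gluing, coordinate-free -/

section Conn

variable (n : Fin 4 → ℤ) {w : ℤ} (hw : ∀ j, w ≤ n j + n (j + 2) - 4) (hw1 : 1 ≤ w)

include hw hw1 in
/-- **The ring is connected** (`TouchLower.ring_conn` in the frame of side `k'`): on the ring event, every endpoint of
every crossing of every strip is joined inside the interior to the start `a₀` of any given crossing of the strip of
side `k'`. -/
theorem ring_conn_lattice (k' : Fin 4) {ω : BondConfig (Site 2)} (hω : ω ⊆ (zdGraph 2).edgeSet) (hR : ω ∈ ringEv[n, w])
    {a₀ b₀ : Site 2} (ha₀ : a₀ ∈ face[n, k' + 3]) (hb₀ : b₀ ∈ face[n, k' + 1])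
    (h₀ : ω ∈ openConnIn strip[n, w, k'] a₀ b₀) :
    ∀ (j : Fin 4) (a b : Site 2), a ∈ face[n, j + 3] → b ∈ face[n, j + 1] → ω ∈ openConnIn strip[n, w, j] a b →
      ω ∈ openConnIn boxI[n] a a₀ ∧ ω ∈ openConnIn boxI[n] b a₀ := by
  have hT := hw k'
  have hL := width_succ n k' hw
  rw [mem_ringEv_iff n k', crossEv_self n k' hw, crossEv_succ n k' hw, crossEv_add_two n k' hw, crossEv_add_three n k' hw]
    at hR
  obtain ⟨r0, r1, r2, r3⟩ := hR
  rw [face_add_three] at ha₀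
  rw [face_succ] at hb₀
  rw [strip_self n k' hw] at h₀
  have ha₀ : layerFn (k' + 3) a₀ = 2 - n (k' + 3) := ha₀
  have hb₀ : layerFn (k' + 3) b₀ = n (k' + 1) - 2 := hb₀
  obtain ⟨c0, c1, c2, c3⟩ := TouchLower.ring_conn (X := layerFn (k' + 3)) (Y := fun v => dp[n, k', v]) (emb := SE[n, k'])
    (κ := 1) (sideEmb_isIsoradial n k') (sideEmb_isRhombicTiling n k') one_pos (sideEmb_re n k') (sideEmb_im n k') hω
    (L₁ := 2 - n (k' + 3)) (L₂ := n (k' + 1) - 2) (T := n k' + n (k' + 2) - 4) (w := w) hw1 hT (by omega)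
    ⟨⟨⟨r0, r1⟩, r2⟩, r3⟩ ha₀ hb₀ h₀
  rw [← boxI_eq] at c0 c1 c2 c3
  intro j a b ha hb hab
  obtain ⟨m, rfl⟩ := exists_eq_add k' j
  fin_cases m
  · simp only [Fin.zero_eta, add_zero] at ha hb hab
    rw [face_add_three] at ha
    rw [face_succ] at hb
    rw [strip_self n k' hw] at hab
    exact c0 a b ha hb hab
  · simp only [Fin.mk_one] at ha hb hab
    rw [fin4_add_one_add_three] at ha
    rw [fin4_add_one_add_one, face_add_two] at hb
    rw [strip_succ n k' hw] at hab
    exact c1 a b ha hb hab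
  · simp only [Fin.reduceFinMk] at ha hb hab
    rw [fin4_add_two_add_three, face_succ] at ha
    rw [fin4_add_two_add_one, face_add_three] at hb
    rw [strip_add_two n k' hw] at hab
    obtain ⟨e1, e2⟩ := c2 b a hb ha (HalfPlaneArm.conn_symm hab)
    exact ⟨e2, e1⟩
  · simp only [Fin.reduceFinMk] at ha hb hab
    rw [fin4_add_three_add_three, face_add_two] at ha
    rw [fin4_add_three_add_one] at hb
    rw [strip_add_three n k' hw] at hab
    obtain ⟨e1, e2⟩ := c3 b a hb ha (HalfPlaneArm.conn_symm hab)
    exact ⟨e2, e1⟩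

include hw hw1 in
/-- **The connector meets the strip of its side** (`TouchLower.connector_conn` in the frame of side `k'`). -/
theorem connector_conn_lattice (k' : Fin 4) {lo : ℤ} (hlo : 2 - n (k' + 3) ≤ lo) (hlo' : lo + w ≤ n (k' + 1) - 2)
    {ω : BondConfig (Site 2)} (hω : ω ⊆ (zdGraph 2).edgeSet) {y t : Site 2} (hy : dp[n, k', y] = -1) (ht : dp[n, k', t] = w)
    (hQ : ω ∈ openConnIn connQ[n, w, k', lo] y t) {a₀ b₀ : Site 2} (ha₀ : a₀ ∈ face[n, k' + 3])
    (hb₀ : b₀ ∈ face[n, k' + 1]) (h₀ : ω ∈ openConnIn strip[n, w, k'] a₀ b₀) :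
    ω ∈ openConnIn (boxI[n] ∪ connQ[n, w, k', lo]) y a₀ := by
  rw [face_add_three] at ha₀
  rw [face_succ] at hb₀
  rw [strip_self n k' hw] at h₀
  have key := TouchLower.connector_conn (X := layerFn (k' + 3)) (Y := fun v => dp[n, k', v]) (emb := SE[n, k']) (κ := 1)
    (sideEmb_isIsoradial n k') (sideEmb_isRhombicTiling n k') one_pos (sideEmb_re n k') (sideEmb_im n k') hω
    (L₁ := 2 - n (k' + 3)) (L₂ := n (k' + 1) - 2) (w := w) (lo := lo) hw1 hlo hlo' hy ht hQ ha₀ hb₀ h₀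
  beta_reduce at key
  refine openConnIn_mono (union_subset_union_left _ ?_) _ _ key
  rw [← strip_self n k' hw]
  exact fun v hv => hv.1

include hw hw1 in
/-- **The arm of a touch-row site is glued to the strip of its side** (`TouchLower.arm_conn` in the frame of side `k`):
on the arm event to distance `2m`, the U event at scale `m` and the vertical connector event at `x`, the site `x` is
joined inside the interior to the start of any crossing of the strip of side `k` (`w ≤ 3m`, and the half-box of the arm
fits in the interior). -/
theorem arm_conn_lattice (k : Fin 4) {x : Site 2} (hx : dp[n, k, x] = 0) {m : ℤ} (hm : 1 ≤ m) (hw3 : w ≤ 3 * m)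
    (h3m : 3 * m ≤ n k + n (k + 2) - 4) (hL₁ : 2 - n (k + 3) ≤ layerFn (k + 3) x - 2 * m)
    (hL₂ : layerFn (k + 3) x + 2 * m ≤ n (k + 1) - 2)
    {ω : BondConfig (Site 2)} (hω : ω ⊆ (zdGraph 2).edgeSet) (hA : ω ∈ armEv[n, k, x, 2 * m]) (hU : ω ∈ uEv[n, k, x, m])
    (hV : ω ∈ vEv[n, k, x, m]) {a₀ b₀ : Site 2} (ha₀ : a₀ ∈ face[n, k + 3]) (hb₀ : b₀ ∈ face[n, k + 1])
    (h₀ : ω ∈ openConnIn strip[n, w, k] a₀ b₀) : ω ∈ openConnIn boxI[n] x a₀ := by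
  rw [face_add_three] at ha₀
  rw [face_succ] at hb₀
  rw [strip_self n k hw] at h₀
  obtain ⟨p, hp, r, hr, hV⟩ := hV
  have key := TouchLower.arm_conn (X := layerFn (k + 3)) (Y := fun v => dp[n, k, v]) (emb := SE[n, k]) (κ := 1)
    (layerFn_le_of_adj (k + 3)) (dp_le_of_adj n k) (sideEmb_isIsoradial n k) (sideEmb_isRhombicTiling n k) one_pos
    (sideEmb_re n k) (sideEmb_im n k) hω hx hm (L₁ := 2 - n (k + 3)) (L₂ := n (k + 1) - 2) hw1 hw3 hL₁ hL₂ hA hU hp hr hV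
    ha₀ hb₀ h₀
  beta_reduce at key
  refine openConnIn_mono ?_ _ _ key
  rw [boxI_eq n k]
  rintro v (((hv | hv) | hv) | hv)
  · obtain ⟨h1, h2⟩ := hv
    rw [hx, max_le_iff, abs_le] at h2
    exact ⟨by omega, by omega, h1, by omega⟩
  · obtain ⟨h1, h2, h3, h4⟩ := hv
    exact ⟨by omega, by omega, h3, by omega⟩
  · obtain ⟨h1, h2, h3, h4⟩ := hv
    rw [hx] at h4
    exact ⟨by omega, by omega, h3, by omega⟩
  · obtain ⟨h1, h2, h3, h4⟩ := hv
    have := hw k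
    exact ⟨h1, h2, h3, by omega⟩

include hw hw1 in
/-- **The gluing, assembled.** On the arm, U and vertical connector events of a touch-row site `x` of side `k`, the ring
event, and the connector event of side `k'` at position `lo`, the site `x` is joined, inside the interior together with
the connector, to a site of the boundary layer `dp[n, k', ·] = −1` of the connector. -/
theorem site_conn (k k' : Fin 4) {x : Site 2} (hx : dp[n, k, x] = 0) {m : ℤ} (hm : 1 ≤ m) (hw3 : w ≤ 3 * m)
    (h3m : 3 * m ≤ n k + n (k + 2) - 4) (hL₁ : 2 - n (k + 3) ≤ layerFn (k + 3) x - 2 * m)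
    (hL₂ : layerFn (k + 3) x + 2 * m ≤ n (k + 1) - 2) {lo : ℤ} (hlo : 2 - n (k' + 3) ≤ lo) (hlo' : lo + w ≤ n (k' + 1) - 2)
    {ω : BondConfig (Site 2)} (hω : ω ⊆ (zdGraph 2).edgeSet) (hA : ω ∈ armEv[n, k, x, 2 * m]) (hU : ω ∈ uEv[n, k, x, m])
    (hV : ω ∈ vEv[n, k, x, m]) (hR : ω ∈ ringEv[n, w]) (hQ : ω ∈ connEv[n, w, k', lo]) :
    ∃ y : Site 2, dp[n, k', y] = -1 ∧ lo ≤ layerFn (k' + 3) y ∧ layerFn (k' + 3) y ≤ lo + w ∧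
      ω ∈ openConnIn (boxI[n] ∪ connQ[n, w, k', lo]) x y := by
  have hRk : ω ∈ crossEv[n, w, k] := ((mem_ringEv_iff n k w).1 hR).1
  have hRk' : ω ∈ crossEv[n, w, k'] := ((mem_ringEv_iff n k' w).1 hR).1
  obtain ⟨a₀, ha₀, b₀, hb₀, h₀⟩ := hRk
  obtain ⟨a', ha', b', hb', h'⟩ := hRk'
  obtain ⟨y, hy, t, ht, hyt⟩ := hQ
  have hy : dp[n, k', y] = -1 := hy
  have ht : dp[n, k', t] = w := ht
  refine ⟨y, hy, hyt.1.1, hyt.1.2.1, ?_⟩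
  have c1 : ω ∈ openConnIn boxI[n] x a₀ := arm_conn_lattice n hw hw1 k hx hm hw3 h3m hL₁ hL₂ hω hA hU hV ha₀ hb₀ h₀
  have c2 : ω ∈ openConnIn boxI[n] a₀ a' := (ring_conn_lattice n hw hw1 k' hω hR ha' hb' h' k a₀ b₀ ha₀ hb₀ h₀).1
  have c3 : ω ∈ openConnIn (boxI[n] ∪ connQ[n, w, k', lo]) y a' :=
    connector_conn_lattice n hw hw1 k' hlo hlo' hω hy ht hyt ha' hb' h'
  exact HalfPlaneArm.conn_trans subset_union_left subset_rfl (HalfPlaneArm.conn_trans subset_rfl subset_rfl c1 c2)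
    (HalfPlaneArm.conn_symm c3)

end Conn

/-- **Registered form of `forall_dp_nonneg_iff` (helper of `freeTouchLower_of_diagArmLower`), notation-free: the interior of
the lattice box read in the frame of side `k`.** -/
theorem touchLower_forall_dp_nonneg_iff : ∀ (n : Fin 4 → ℤ) (k : Fin 4) (x : Site 2), (∀ j : Fin 4, 0 ≤ n j - 2 - layerFn (j + 2) x) ↔ 2 - n (k + 3) ≤ layerFn (k + 3) x ∧ layerFn (k + 3) x ≤ n (k + 1) - 2 ∧ 0 ≤ n k - 2 - layerFn (k + 2) x ∧ n k - 2 - layerFn (k + 2) x ≤ n k + n (k + 2) - 4 :=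
  fun n k x => forall_dp_nonneg_iff n k x

end Summit.CriticalPhenomena.CardyFormulaZ2.Cruxes.ParafermionToSLESixFamilies.PotentialDarbouxPicardDiamond

end
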